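import Literature.NumberTheory.Automorphic.BruhatDecompositionGL
import HarnessLib

/-!
# The double cosets `P_c \ GL_n(K) / U_n` and their south-west rank invariants

Topic `NumberTheory/Automorphic`. Let `K` be a field, `c : Fin n → α` a block labelling and
`P_c ≤ GL_n(K)` the standard (block upper triangular) parabolic subgroup, `U = U_n(K)` the upper
unitriangular group. For `g ∈ GL_n(K)`, a block label `a` and `j ≤ n` put

* `swRank c g a j = rank` of the **south-west block** of `g` on the rows `{i : a ≤ c i}` and the
  columns `{k : k < j}` (`swBlock`).

These numbers are invariant under `g ↦ p g u` (`p ∈ P_c`, `u ∈ U`; `swRank_parabolic_mul`,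
`swRank_mul_upperUnitriangular`), on a permutation matrix `P_σ` (`(P_σ)_{ik} = [σ i = k]`) they
are the counts `blockCount c σ a j = #{i : a ≤ c i, σ i < j}` (`swRank_permMatrix`), and these
counts determine the *block word* `k ↦ c (σ⁻¹ k)` of `σ` (`comp_symm_eq_of_blockCount_eq`),
which in turn determines the double coset: `P_c P_τ U = P_c P_σ U` iff `c ∘ τ⁻¹ = c ∘ σ⁻¹`
(`permGL_eq_parabolic_mul_permGL`). Together with the Bruhat decomposition
`GL_n(K) = ⋃_σ P_c P_σ U` (`BruhatDecompositionGL`, for monotone `c`) this gives the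
classification of the `(P_c, U)`-double cosets by the rank invariants:

* `mem_parabolicDoubleCoset_iff_swRank_eq` — `g ∈ P_c P_σ U ↔ swRank c g = blockCount c σ`;
* `parabolicDoubleCoset_eq_or_disjoint`, `iUnion_parabolicDoubleCoset` — the double cosets
  `parabolicDoubleCoset c σ` partition `GL_n(K)`.

This is the relative Bruhat decomposition `P_I \ G / B ↔ W_I \ W` for `GL_n`
(Malle–Testerman 2011, Thm. 11.17: `G = ⊔_{w ∈ W} B ẇ B`, and Prop. 12.2 (a):
`P_I = ⊔_{w ∈ W_I} B ẇ B`), with the double cosets told apart by ranks of south-west corner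
submatrices exactly as the `B`-orbits on the flag manifold are told apart by the numbers
`dim (E_p ∩ F_q) = #{i ≤ p : w(i) ≤ q}` in Fulton, *Young tableaux* (1997), §10.2 ("these Schubert
cells are exactly the orbits of the group `B` of upper triangular matrices"). Everything is
proved; the only definitions are `swBlock`, `swRank`, `blockCount` and `parabolicDoubleCoset`
(with bodies); no named fact.

## References

* G. Malle, D. Testerman, *Linear Algebraic Groups and Finite Groups of Lie Type*, CUP (2011),
  Thm. 11.17, §12.1. [MalleTesterman2011]
* W. Fulton, *Young Tableaux*, LMS Student Texts 35, CUP (1997), §10.2, Schubert cells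
  `X_w° = {E_• : dim (E_p ∩ F_q) = #{i ≤ p : w(i) ≤ q}}` as `B`-orbits (held; PDF pp. 149–151).
  [FultonYoungTableaux1997]
* D. Goldfeld, *Automorphic Forms and L-Functions for the Group GL(n, ℝ)* (2006), Prop. 10.3.2.
  [Goldfeld2006]
-/

namespace Literature.NumberTheory.Automorphic

open Matrix

section Field

variable {K : Type*} [Field K] {n : ℕ} {α : Type*} [LinearOrder α] (c : Fin n → α)

/-! ### South-west blocks and their ranks -/

/-- The **south-west block** of `g` attached to a block label `a` and a column bound `j`: the
submatrix on the rows `{i : a ≤ c i}` (the last blocks) and the columns `{k : k < j}` (the first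
`j` columns). [folklore] -/
def swBlock (g : Matrix (Fin n) (Fin n) K) (a : α) (j : ℕ) :
    Matrix {i : Fin n // a ≤ c i} {k : Fin n // (k : ℕ) < j} K :=
  g.submatrix Subtype.val Subtype.val

omit [Field K] in
/-- Entries of the south-west block. [folklore] -/
@[simp] lemma swBlock_apply (g : Matrix (Fin n) (Fin n) K) (a : α) (j : ℕ)
    (i : {i : Fin n // a ≤ c i}) (k : {k : Fin n // (k : ℕ) < j}) :
    swBlock c g a j i k = g i k := rfl

/-- The **south-west rank** `swRank c g a j = rank (swBlock c g a j)`, the invariant of the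
`(P_c, U_n)`-double coset of `g` (the matrix form of Fulton's numbers `dim (E_p ∩ F_q)` cutting out
the Schubert cells, Fulton 1997, §10.2). [cite: FultonYoungTableaux1997, §10.2 (PDF p. 150)] -/
noncomputable def swRank (g : Matrix (Fin n) (Fin n) K) (a : α) (j : ℕ) : ℕ :=
  (swBlock c g a j).rank

/-! ### Multiplicativity of corner blocks against (block) triangular matrices -/

/-- If `p` is block upper triangular for `c`, the rows `{a ≤ c i}` of `p g` only involve the rows
`{a ≤ c l}` of `g`: `(p g)[R_a, C] = p[R_a, R_a] · g[R_a, C]` for every set of columns `C`.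
[folklore] -/
theorem submatrix_mul_of_blockTriangular {p : Matrix (Fin n) (Fin n) K} (hp : p.BlockTriangular c)
    (g : Matrix (Fin n) (Fin n) K) (a : α) {β : Type*} (e : β → Fin n) :
    (p * g).submatrix (Subtype.val : {i : Fin n // a ≤ c i} → Fin n) e =
      p.submatrix (Subtype.val : {i : Fin n // a ≤ c i} → Fin n) Subtype.val *
        g.submatrix (Subtype.val : {i : Fin n // a ≤ c i} → Fin n) e := by
  ext i k
  change (p * g) i (e k) = ∑ l : {l : Fin n // a ≤ c l}, p i l * g l (e k)
  rw [Matrix.mul_apply, ← Finset.sum_subset (Finset.filter_subset (fun l => a ≤ c l) Finset.univ)]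
  · exact Finset.sum_subtype (p := fun l => a ≤ c l) _ (fun l => by simp) (fun l => p i l * g l (e k))
  · intro l _ hl
    simp only [Finset.mem_filter, Finset.mem_univ, true_and, not_le] at hl
    rw [hp (lt_of_lt_of_le hl i.2), zero_mul]

/-- If `u` is upper triangular, the first `j` columns of `g u` only involve the first `j` columns
of `g`: `(g u)[R, C_j] = g[R, C_j] · u[C_j, C_j]` for every set of rows `R`. [folklore] -/
theorem submatrix_mul_of_upperTriangular {u : Matrix (Fin n) (Fin n) K} (hu : u.BlockTriangular id)
    (g : Matrix (Fin n) (Fin n) K) {β : Type*} (e : β → Fin n) (j : ℕ) :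
    (g * u).submatrix e (Subtype.val : {k : Fin n // (k : ℕ) < j} → Fin n) =
      g.submatrix e (Subtype.val : {k : Fin n // (k : ℕ) < j} → Fin n) *
        u.submatrix (Subtype.val : {k : Fin n // (k : ℕ) < j} → Fin n) Subtype.val := by
  ext i k
  change (g * u) (e i) k = ∑ m : {m : Fin n // (m : ℕ) < j}, g (e i) m * u m k
  rw [Matrix.mul_apply,
    ← Finset.sum_subset (Finset.filter_subset (fun m : Fin n => (m : ℕ) < j) Finset.univ)]
  · exact Finset.sum_subtype (p := fun m : Fin n => (m : ℕ) < j) _ (fun m => by simp)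
      (fun m => g (e i) m * u m k)
  · intro m _ hm
    simp only [Finset.mem_filter, Finset.mem_univ, true_and, not_lt] at hm
    have hkm : (k : Fin n) < m := Fin.lt_def.2 (lt_of_lt_of_le k.2 hm)
    rw [hu hkm, mul_zero]

/-- The identity matrix restricted to a set of indices is the identity. [folklore] -/
theorem one_submatrix_subtypeVal (q : Fin n → Prop) :
    (1 : Matrix (Fin n) (Fin n) K).submatrix (Subtype.val : {i // q i} → Fin n)
      (Subtype.val : {i // q i} → Fin n) = 1 := by
  ext i k
  simp only [Matrix.submatrix_apply, Matrix.one_apply, Subtype.val_inj]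

/-- The diagonal corner `p[R_a, R_a]` of an element of `P_c` is invertible (its inverse is
`p⁻¹[R_a, R_a]`). [folklore] -/
theorem isUnit_det_submatrix_of_mem_standardParabolicGL {p : GL (Fin n) K}
    (hp : p ∈ standardParabolicGL K c) (a : α) :
    IsUnit ((p : Matrix (Fin n) (Fin n) K).submatrix
      (Subtype.val : {i : Fin n // a ≤ c i} → Fin n) Subtype.val).det := by
  have h := submatrix_mul_of_blockTriangular c (p := (p : Matrix (Fin n) (Fin n) K)) hp
    ((p⁻¹ : GL (Fin n) K) : Matrix (Fin n) (Fin n) K) a (Subtype.val : {i : Fin n // a ≤ c i} → Fin n)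
  rw [← Units.val_mul, mul_inv_cancel, Units.val_one, one_submatrix_subtypeVal] at h
  exact Matrix.isUnit_det_of_right_inverse h.symm

/-- The corner `u[C_j, C_j]` of an upper unitriangular `u` is invertible (its inverse is
`u⁻¹[C_j, C_j]`). [folklore] -/
theorem isUnit_det_submatrix_of_mem_upperUnitriangular {u : GL (Fin n) K}
    (hu : u ∈ upperUnitriangular (Fin n) K) (j : ℕ) :
    IsUnit ((u : Matrix (Fin n) (Fin n) K).submatrix
      (Subtype.val : {k : Fin n // (k : ℕ) < j} → Fin n) Subtype.val).det := by
  have hu' : ((u⁻¹ : GL (Fin n) K) : Matrix (Fin n) (Fin n) K).BlockTriangular id :=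
    ((mem_upperUnitriangular_iff _).1 (Subgroup.inv_mem _ hu)).1
  have h := submatrix_mul_of_upperTriangular (K := K) hu' (u : Matrix (Fin n) (Fin n) K)
    (Subtype.val : {k : Fin n // (k : ℕ) < j} → Fin n) j
  rw [← Units.val_mul, mul_inv_cancel, Units.val_one, one_submatrix_subtypeVal] at h
  exact Matrix.isUnit_det_of_right_inverse h.symm

/-! ### Invariance of the south-west ranks under `P_c × U_n` -/

/-- **Left `P_c`-invariance**: `swRank c (p g) = swRank c g` for `p ∈ P_c`. [folklore] -/
theorem swRank_parabolic_mul {p : GL (Fin n) K} (hp : p ∈ standardParabolicGL K c)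
    (g : Matrix (Fin n) (Fin n) K) (a : α) (j : ℕ) :
    swRank c ((p : Matrix (Fin n) (Fin n) K) * g) a j = swRank c g a j := by
  unfold swRank swBlock
  rw [submatrix_mul_of_blockTriangular c hp]
  exact Matrix.rank_mul_eq_right_of_isUnit_det _ _
    (isUnit_det_submatrix_of_mem_standardParabolicGL c hp a)

/-- **Right `U_n`-invariance**: `swRank c (g u) = swRank c g` for `u ∈ U_n`. [folklore] -/
theorem swRank_mul_upperUnitriangular {u : GL (Fin n) K} (hu : u ∈ upperUnitriangular (Fin n) K)
    (g : Matrix (Fin n) (Fin n) K) (a : α) (j : ℕ) :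
    swRank c (g * (u : Matrix (Fin n) (Fin n) K)) a j = swRank c g a j := by
  unfold swRank swBlock
  rw [submatrix_mul_of_upperTriangular ((mem_upperUnitriangular_iff _).1 hu).1]
  exact Matrix.rank_mul_eq_left_of_isUnit_det _ _
    (isUnit_det_submatrix_of_mem_upperUnitriangular hu j)

/-- **Double coset invariance**: `swRank c (p g u) = swRank c g`. [folklore] -/
theorem swRank_parabolic_mul_mul_upperUnitriangular {p : GL (Fin n) K}
    (hp : p ∈ standardParabolicGL K c) {u : GL (Fin n) K} (hu : u ∈ upperUnitriangular (Fin n) K)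
    (g : GL (Fin n) K) :
    swRank c ((p * g * u : GL (Fin n) K) : Matrix (Fin n) (Fin n) K) =
      swRank c (g : Matrix (Fin n) (Fin n) K) := by
  funext a j
  rw [Units.val_mul, Units.val_mul, swRank_mul_upperUnitriangular c hu, swRank_parabolic_mul c hp]

/-! ### The ranks of a permutation matrix -/

/-- The **block counts** of a permutation: `blockCount c σ a j = #{i : a ≤ c i ∧ σ i < j}`, the
number of ones of `P_σ` in the south-west block of rows `{a ≤ c i}` and columns `{k < j}`.
[folklore] -/
def blockCount (σ : Equiv.Perm (Fin n)) (a : α) (j : ℕ) : ℕ :=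
  (Finset.univ.filter fun i : Fin n => a ≤ c i ∧ ((σ i : Fin n) : ℕ) < j).card

/-- **The south-west ranks of a permutation matrix are its block counts**: the corner of `P_σ` is
a partial permutation matrix whose column space is spanned by the `#{i : a ≤ c i, σ i < j}`
distinct standard basis vectors `e_i`. [folklore] -/
theorem swRank_permMatrix (σ : Equiv.Perm (Fin n)) (a : α) (j : ℕ) :
    swRank c (σ.permMatrix K) a j = blockCount c σ a j := by
  classical
  unfold swRank
  set R := {i : Fin n // a ≤ c i}
  set S : Matrix R {k : Fin n // (k : ℕ) < j} K := swBlock c (σ.permMatrix K) a j with hS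
  -- the index set of the ones in the corner, and the corresponding standard basis vectors
  set T := {i : R // ((σ (i : Fin n) : Fin n) : ℕ) < j}
  set b : T → (R → K) := fun t => Pi.single (t : R) 1 with hb
  have hli : LinearIndependent K b := by
    have := (Pi.basisFun K R).linearIndependent.comp (fun t : T => (t : R)) Subtype.val_injective
    convert this using 1
    funext t
    simp [hb, Function.comp, Pi.basisFun_apply]
  have hScol : ∀ (k : {k : Fin n // (k : ℕ) < j}) (i : R), S.col k i = if σ i = k then 1 else 0 :=
    fun k i => by simp [Matrix.col, hS]
  have hST : Submodule.span K (Set.range S.col) = Submodule.span K (Set.range b) := by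
    apply le_antisymm
    · rw [Submodule.span_le]
      rintro _ ⟨k, rfl⟩
      by_cases h : a ≤ c (σ.symm (k : Fin n))
      · have ht : ((σ ((⟨σ.symm k, h⟩ : R) : Fin n) : Fin n) : ℕ) < j := by simpa using k.2
        have : S.col k = b ⟨⟨σ.symm k, h⟩, ht⟩ := by
          ext i
          have hiff : (σ (i : Fin n) = (k : Fin n)) ↔ i = ⟨σ.symm k, h⟩ := by
            rw [Subtype.ext_iff]
            exact (Equiv.eq_symm_apply σ).symm
          simp only [hScol, hb, Pi.single_apply]
          by_cases hi : σ (i : Fin n) = (k : Fin n)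
          · rw [if_pos hi, if_pos (hiff.1 hi)]
          · rw [if_neg hi, if_neg (fun h' => hi (hiff.2 h'))]
        rw [this]
        exact Submodule.subset_span ⟨_, rfl⟩
      · have : S.col k = 0 := by
          ext i
          rw [hScol, Pi.zero_apply, ite_eq_right_iff]
          intro hik
          exfalso
          apply h
          rw [← hik, Equiv.symm_apply_apply]
          exact i.2
        rw [this]
        exact Submodule.zero_mem _
    · rw [Submodule.span_le]
      rintro _ ⟨t, rfl⟩
      have : b t = S.col ⟨σ ((t : R) : Fin n), t.2⟩ := by
        ext i
        simp only [hScol, hb, Pi.single_apply]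
        have hiff : i = (t : R) ↔ σ (i : Fin n) = σ ((t : R) : Fin n) := by
          rw [σ.injective.eq_iff, Subtype.ext_iff]
        by_cases hi : i = (t : R)
        · rw [if_pos hi, if_pos (hiff.1 hi)]
        · rw [if_neg hi, if_neg (fun h' => hi (hiff.2 h'))]
      rw [this]
      exact Submodule.subset_span ⟨_, rfl⟩
  rw [Matrix.rank_eq_finrank_span_cols, hST, finrank_span_eq_card hli]
  -- count
  rw [blockCount, Fintype.card_congr (Equiv.subtypeSubtypeEquivSubtypeInter
    (fun i : Fin n => a ≤ c i) (fun i : Fin n => ((σ i : Fin n) : ℕ) < j)), Fintype.card_subtype]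

/-- On the double coset `P_c P_σ U` the south-west ranks are the block counts of `σ`. [folklore] -/
theorem swRank_parabolic_mul_permGL_mul {p : GL (Fin n) K} (hp : p ∈ standardParabolicGL K c)
    (σ : Equiv.Perm (Fin n)) {u : GL (Fin n) K} (hu : u ∈ upperUnitriangular (Fin n) K) :
    swRank c ((p * permGL σ * u : GL (Fin n) K) : Matrix (Fin n) (Fin n) K) = blockCount c σ := by
  rw [swRank_parabolic_mul_mul_upperUnitriangular c hp hu]
  funext a j
  rw [coe_permGL, swRank_permMatrix]

/-! ### The block counts determine the block word `c ∘ σ⁻¹`, hence the double coset -/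

/-- Recursion for the block counts in the column bound: passing from `j` to `j + 1` adds the one
of the column `j`, which lies in the row `σ⁻¹ j`. [folklore] -/
theorem blockCount_succ (σ : Equiv.Perm (Fin n)) (a : α) (k : Fin n) :
    blockCount c σ a ((k : ℕ) + 1) =
      blockCount c σ a k + if a ≤ c (σ.symm k) then 1 else 0 := by
  classical
  unfold blockCount
  rw [Finset.card_filter, Finset.card_filter]
  rw [show (∑ i : Fin n, if a ≤ c i ∧ ((σ i : Fin n) : ℕ) < (k : ℕ) + 1 then 1 else 0) =
      ∑ i : Fin n, ((if a ≤ c i ∧ ((σ i : Fin n) : ℕ) < (k : ℕ) then 1 else 0) +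
        (if a ≤ c i ∧ σ i = k then 1 else 0)) from Finset.sum_congr rfl fun i _ => by
      rcases lt_trichotomy (σ i) k with h | h | h
      · have h' : ((σ i : Fin n) : ℕ) < (k : ℕ) := Fin.lt_def.1 h
        simp [h', h.ne, Nat.lt_succ_of_lt h']
      · subst h
        simp
      · have h1 : ¬ ((σ i : Fin n) : ℕ) < (k : ℕ) + 1 := by
          have := Fin.lt_def.1 h; omega
        have h2 : ¬ ((σ i : Fin n) : ℕ) < (k : ℕ) := by
          have := Fin.lt_def.1 h; omega
        simp [h1, h2, h.ne']]
  rw [Finset.sum_add_distrib]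
  congr 1
  rw [Finset.sum_eq_single (σ.symm k)]
  · simp
  · intro i _ hi
    have : σ i ≠ k := fun h => hi (by rw [← h, Equiv.symm_apply_apply])
    simp [this]
  · intro h
    exact absurd (Finset.mem_univ _) h

/-- **The block counts determine the block word**: if `blockCount c σ = blockCount c τ` then
`c (σ⁻¹ k) = c (τ⁻¹ k)` for every column `k`. [folklore] -/
theorem comp_symm_eq_of_blockCount_eq {σ τ : Equiv.Perm (Fin n)}
    (h : blockCount c σ = blockCount c τ) : c ∘ σ.symm = c ∘ τ.symm := by
  have key : ∀ (a : α) (k : Fin n), (a ≤ c (σ.symm k) ↔ a ≤ c (τ.symm k)) := by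
    intro a k
    have h1 := blockCount_succ c σ a k
    have h2 := blockCount_succ c τ a k
    rw [h] at h1
    have h3 : (if a ≤ c (σ.symm k) then 1 else 0 : ℕ) = if a ≤ c (τ.symm k) then 1 else 0 :=
      Nat.add_left_cancel (h1.symm.trans h2)
    by_cases hσ : a ≤ c (σ.symm k)
    · by_cases hτ : a ≤ c (τ.symm k)
      · exact ⟨fun _ => hτ, fun _ => hσ⟩
      · rw [if_pos hσ, if_neg hτ] at h3
        exact absurd h3 one_ne_zero
    · by_cases hτ : a ≤ c (τ.symm k)
      · rw [if_neg hσ, if_pos hτ] at h3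
        exact absurd h3.symm one_ne_zero
      · exact ⟨fun h' => absurd h' hσ, fun h' => absurd h' hτ⟩
  funext k
  exact le_antisymm ((key _ k).1 le_rfl) ((key _ k).2 le_rfl)

/-- Products of permutation matrices: `P_ρ P_σ = P_{σ ρ}` for `(P_σ)_{ik} = [σ i = k]`
(`Equiv.Perm` multiplication `(σ * ρ) i = σ (ρ i)`). [folklore] -/
theorem permGL_mul_permGL (ρ σ : Equiv.Perm (Fin n)) :
    (permGL ρ * permGL σ : GL (Fin n) K) = permGL (σ * ρ) := by
  refine Units.ext ?_
  rw [Units.val_mul, coe_permGL, coe_permGL, coe_permGL, Equiv.Perm.permMatrix,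
    Equiv.Perm.permMatrix, Equiv.Perm.permMatrix, Equiv.Perm.mul_def, Equiv.toPEquiv_trans,
    PEquiv.toMatrix_trans]

/-- A permutation matrix `P_ρ` lies in `P_c` as soon as `ρ` does not decrease block labels
(`c i ≤ c (ρ i)` for all `i`; for a permutation this forces `c ∘ ρ = c`). [folklore] -/
theorem permGL_mem_standardParabolicGL {ρ : Equiv.Perm (Fin n)} (hρ : ∀ i, c i ≤ c (ρ i)) :
    (permGL ρ : GL (Fin n) K) ∈ standardParabolicGL K c := by
  intro i k hki
  rw [coe_permGL, permMatrix_apply']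
  split_ifs with h
  · exact absurd (h ▸ hρ i) (not_le.2 hki)
  · rfl

/-- **Equal block words give the same double coset**: if `c ∘ τ⁻¹ = c ∘ σ⁻¹` then
`P_τ = P_ρ P_σ` with `P_ρ ∈ P_c` (`ρ = σ⁻¹ τ` preserves the block labels), so
`P_c P_τ U = P_c P_σ U`. [folklore] -/
theorem permGL_eq_parabolic_mul_permGL {σ τ : Equiv.Perm (Fin n)}
    (h : c ∘ τ.symm = c ∘ σ.symm) :
    ∃ p ∈ standardParabolicGL K c, (permGL τ : GL (Fin n) K) = p * permGL σ := by
  refine ⟨permGL (σ⁻¹ * τ), permGL_mem_standardParabolicGL c fun i => ?_, ?_⟩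
  · have := congrFun h (τ i)
    simp only [Function.comp_apply, Equiv.symm_apply_apply] at this
    rw [Equiv.Perm.mul_apply, this]
    rfl
  · rw [permGL_mul_permGL, ← mul_assoc, mul_inv_cancel, one_mul]

/-! ### The double cosets `P_c P_σ U_n` and their classification by the ranks -/

/-- The **`(P_c, U_n)`-double coset** of the permutation matrix `P_σ`:
`P_c P_σ U_n = {p P_σ u : p ∈ P_c, u ∈ U_n}`. [folklore] -/
def parabolicDoubleCoset (σ : Equiv.Perm (Fin n)) : Set (GL (Fin n) K) :=
  {g | ∃ p ∈ standardParabolicGL K c, ∃ u ∈ upperUnitriangular (Fin n) K, g = p * permGL σ * u}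

/-- Membership in `P_c P_σ U_n`. [folklore] -/
lemma mem_parabolicDoubleCoset_iff (σ : Equiv.Perm (Fin n)) (g : GL (Fin n) K) :
    g ∈ parabolicDoubleCoset (K := K) c σ ↔
      ∃ p ∈ standardParabolicGL K c, ∃ u ∈ upperUnitriangular (Fin n) K, g = p * permGL σ * u :=
  Iff.rfl

/-- `P_σ ∈ P_c P_σ U_n`. [folklore] -/
lemma permGL_mem_parabolicDoubleCoset (σ : Equiv.Perm (Fin n)) :
    (permGL σ : GL (Fin n) K) ∈ parabolicDoubleCoset (K := K) c σ :=
  ⟨1, Subgroup.one_mem _, 1, Subgroup.one_mem _, by rw [one_mul, mul_one]⟩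

/-- `P_c P_σ U_n` is stable under `g ↦ p g u`. [folklore] -/
lemma mul_mul_mem_parabolicDoubleCoset {σ : Equiv.Perm (Fin n)} {g : GL (Fin n) K}
    (hg : g ∈ parabolicDoubleCoset (K := K) c σ) {p : GL (Fin n) K}
    (hp : p ∈ standardParabolicGL K c) {u : GL (Fin n) K} (hu : u ∈ upperUnitriangular (Fin n) K) :
    p * g * u ∈ parabolicDoubleCoset (K := K) c σ := by
  obtain ⟨p', hp', u', hu', rfl⟩ := hg
  exact ⟨p * p', Subgroup.mul_mem _ hp hp', u' * u, Subgroup.mul_mem _ hu' hu, by group⟩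

/-- **Classification of the double cosets by the south-west ranks** (for a monotone labelling,
so that `B ≤ P_c` and the Bruhat decomposition applies): `g ∈ P_c P_σ U_n` iff
`swRank c g = blockCount c σ`. (The relative Bruhat decomposition `P_I \ G / B ↔ W_I \ W`,
Malle–Testerman 2011, Thm. 11.17 with Prop. 12.2 (a), for `GL_n`, the double cosets being
separated by corner ranks as the Schubert cells are by the numbers
`dim (E_p ∩ F_q) = #{i ≤ p : w(i) ≤ q}` in Fulton 1997, §10.2.)
[cite: MalleTesterman2011, Thm. 11.17 and Prop. 12.2 (a) (pp. 92, 94)] -/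
theorem mem_parabolicDoubleCoset_iff_swRank_eq (hc : Monotone c) (σ : Equiv.Perm (Fin n))
    (g : GL (Fin n) K) :
    g ∈ parabolicDoubleCoset (K := K) c σ ↔
      swRank c (g : Matrix (Fin n) (Fin n) K) = blockCount c σ := by
  constructor
  · rintro ⟨p, hp, u, hu, rfl⟩
    exact swRank_parabolic_mul_permGL_mul c hp σ hu
  · intro h
    obtain ⟨p, τ, u, hp, rfl⟩ := exists_eq_parabolic_mul_permGL_mul_upperUnitriangular hc g
    rw [swRank_parabolic_mul_permGL_mul c hp τ u.2] at h
    obtain ⟨p', hp', hτ⟩ := permGL_eq_parabolic_mul_permGL (K := K) c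
      (comp_symm_eq_of_blockCount_eq c h)
    exact ⟨p * p', Subgroup.mul_mem _ hp hp', u, u.2, by rw [hτ]; group⟩

/-- Two double cosets `P_c P_σ U_n`, `P_c P_τ U_n` are **equal or disjoint**, according as
`blockCount c σ = blockCount c τ` or not. [folklore] -/
theorem parabolicDoubleCoset_eq_or_disjoint (hc : Monotone c) (σ τ : Equiv.Perm (Fin n)) :
    parabolicDoubleCoset (K := K) c σ = parabolicDoubleCoset (K := K) c τ ∨
      Disjoint (parabolicDoubleCoset (K := K) c σ) (parabolicDoubleCoset (K := K) c τ) := by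
  by_cases h : blockCount c σ = blockCount c τ
  · left
    ext g
    rw [mem_parabolicDoubleCoset_iff_swRank_eq c hc, mem_parabolicDoubleCoset_iff_swRank_eq c hc, h]
  · right
    rw [Set.disjoint_left]
    intro g hσ hτ
    rw [mem_parabolicDoubleCoset_iff_swRank_eq c hc] at hσ hτ
    exact h (hσ.symm.trans hτ)

/-- The double cosets `P_c P_σ U_n` with the same block counts coincide. [folklore] -/
theorem parabolicDoubleCoset_eq_of_blockCount_eq (hc : Monotone c) {σ τ : Equiv.Perm (Fin n)}
    (h : blockCount c σ = blockCount c τ) :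
    parabolicDoubleCoset (K := K) c σ = parabolicDoubleCoset (K := K) c τ := by
  ext g
  rw [mem_parabolicDoubleCoset_iff_swRank_eq c hc, mem_parabolicDoubleCoset_iff_swRank_eq c hc, h]

/-- **The double cosets cover `GL_n(K)`** (Bruhat decomposition). [cite: Goldfeld2006, Prop. 10.3.2 (p. 292)] -/
theorem iUnion_parabolicDoubleCoset (hc : Monotone c) :
    ⋃ σ : Equiv.Perm (Fin n), parabolicDoubleCoset (K := K) c σ = Set.univ := by
  refine Set.eq_univ_of_forall fun g => ?_
  obtain ⟨p, σ, u, hp, rfl⟩ := exists_eq_parabolic_mul_permGL_mul_upperUnitriangular hc g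
  exact Set.mem_iUnion.2 ⟨σ, p, hp, u, u.2, rfl⟩

/-- The south-west ranks of every `g` are the block counts of some permutation. [folklore] -/
theorem exists_swRank_eq_blockCount (hc : Monotone c) (g : GL (Fin n) K) :
    ∃ σ : Equiv.Perm (Fin n), swRank c (g : Matrix (Fin n) (Fin n) K) = blockCount c σ := by
  obtain ⟨p, σ, u, hp, rfl⟩ := exists_eq_parabolic_mul_permGL_mul_upperUnitriangular hc g
  exact ⟨σ, swRank_parabolic_mul_permGL_mul c hp σ u.2⟩

end Field

end Literature.NumberTheory.Automorphic
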